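/-
Copyright (c) 2026. All rights reserved.
Released under Apache 2.0 license as described in the file LICENSE.
Authors: abc-iut cell, prover seat abc-iut-L4-t8 (gen 12; row «SB′-E», abc-iut-L4-lead m166 (2)), filling abc-iut-w5-d144's
skeleton (gen 6, sha16 abce66134e7dabd6) over abc-iut-f-101's sufficiency theorem `cor510MonoTelecoreObservablesCompatible_of`
(D2) and its bridges `isOver_embPlusHom_of_isOver` / `isOver_embTSHom_of_isOver`; every carrier-side input is consumed BY NAME
(abc-iut-f-101, abc-iut-w5-d053, abc-iut-w5-d144, abc-iut-L4-t3 lineages) — nothing of those files is re-meant.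
-/
import Literature.AnabelianGeometry.AbsoluteAnabelian.LogFrobeniusMonoTelecoreObservablesOf
import Literature.AnabelianGeometry.AbsoluteAnabelian.LogFrobeniusMonoTelecoreObservablesOverBridge
import Literature.AnabelianGeometry.AbsoluteAnabelian.LogFrobeniusMonoTelecoreObservablesOverBridgeTS
import Literature.AnabelianGeometry.AbsoluteAnabelian.LogFrobeniusMonoTelecoreGenuineOpen
import Literature.AnabelianGeometry.AbsoluteAnabelian.LogFrobeniusMonoGenuineSubIotaOver
import Literature.AnabelianGeometry.AbsoluteAnabelian.LogFrobeniusMonoGenuineIotaOverTS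
import Literature.AnabelianGeometry.AbsoluteAnabelian.LogFrobeniusMonoGenuineSubHolomorphicOver
import Literature.AnabelianGeometry.AbsoluteAnabelian.LogFrobeniusMonoGenuineSubObservablesTS
import Literature.AnabelianGeometry.AbsoluteAnabelian.LogFrobeniusObservablesTSPushSubFamily
import HarnessLib

/-!
# [AbsTopIII] Cor 5.10 (iv)(b): the telecore `𝔗_{An⊢}` is compatible with `S_log`, `S_log⊞` — AT THE GENUINE OPEN-AUGMENTATION CARRIER

S. Mochizuki, *Topics in absolute anabelian geometry III: global reconstruction algorithms* [MochizukiAbsTopIII2015]; locators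
`p.N` = pages of the author's manuscript (`paper:url-5493eb38cbb7`), read on the page: Cor 5.10 (iv)(b) pp. 147–148 ("…
give rise to a telecore structure `𝔗_{An⊢}` on `D•⊢_{≤5} ∪ D•_{≤6}` … Moreover, the respective family of homotopies of `𝔗_{An⊢}` and
the observables `S_log`, `S_log⊞` of Corollary 5.5, (iii), are compatible"), Def 3.5 (ii) p. 75 ("compatible").

PROOF-ONLY file (brick E of the «COR510iv-SB′» chain; no `def`, no instance, no new `Prop` fact).  abc-iut-w5-d144 typed the last
sentence of Cor 5.10 (iv)(b) as the assumption `Cor510MonoTelecoreObservablesCompatible L TS` (p484312); abc-iut-f-101 proved the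
SUFFICIENCY theorem `cor510MonoTelecoreObservablesCompatible_of` (D2: data `hN`, `hψ` of the mono-telecore, observable families
`Hplus`, `Hts`, push `hpush`, over-ness `hoverPlus` / `hoverTS` read in `D_{An⊢}`, observability `hobs`) and the bridges
`isOver_embPlusHom_of_isOver` / `isOver_embTSHom_of_isOver` from the observables' own over-data.  HERE: every binder is DISCHARGED
at the genuine open-augmentation carrier `genuineOpen p V` (𝒳 = `TFModel p` with open augmentations; `V(F_mod) ≠ ∅`, all places
nonarchimedean) with ANY `TS`-datum `T` whose `ι` lie over `Th•[Z]` (`T.IotaOverTS`), in particular the carrier's own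
`genuineOpenTS p V`:
* `TS := T`, `hN := Iso.refl` (the mono-analyticization rows commute on the nose), `hψ :=` abc-iut-f-101's
  `nonarchGenuineMonoAnPfOpen_ψOverIso`, `Hplus v :=` abc-iut-L4-t5's universal `logObsFamily v` (squares commute:
  abc-iut-w5-d053's `genuineOpen_iotaSquaresCommute`), `Hts v := logObsFamilyTS v T` (`genuineOpen_iotaSquaresCommuteTS`),
  `hpush :=` abc-iut-w5-d144's `subFamily_pushFamily_logObsFamilyTS`, `hobs :=` abc-iut-w5-d053's `genuineOpen_isLogObservable_pair`;
* `hoverPlus` / `hoverTS` := the bridges applied to abc-iut-w5-d144's `isOver_logObsFamily_η_map` / `isOver_logObsFamilyTS_η_map`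
  (inputs `IotaOver`, `LamOverLink` of the carrier — abc-iut-f-101's `nonarchGenuineMonoAnPfOpen_iotaOver` / `_lamOverLink` —
  and `T.IotaOverTS`, for the own datum abc-iut-w5-d053's `genuineOpenTS_iotaOverTS`).
Results: `genuineOpen_isOver_embPlusHom`, `genuineOpen_isOver_embTSHom` (the two over-ness binders at the carrier);
★ `cor510MonoTelecoreObservablesCompatible_genuineOpen_of_iotaOverTS` (every `T` with `T.IotaOverTS`);
★★ `cor510MonoTelecoreObservablesCompatible_genuineOpen` (the carrier's own `TS`-datum; zero hypotheses beyond `V ≠ ∅`);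
`…_iff` (⟺ `V ≠ ∅`, abc-iut-w5-d144's degenerate corner); `exists_genuine_cor510MonoTelecoreObservablesCompatible`.
HONEST LABEL: MODEL-LEVEL at a genuine carrier of the cell's own construction (nonarchimedean index sets); the typed statement is
abc-iut-w5-d144's reading of the printed sentence; refereed pre-IUT material; nothing here bears on [IUTchIII] Cor. 3.12; no side
taken; typed ≠ proved elsewhere.
-/

set_option autoImplicit false

universe u

open CategoryTheory Quiver

namespace Literature.AnabelianGeometry.AbsoluteAnabelian

namespace LogFrobeniusSetting

open AbsTopIII DiagramOfCategories

section Instance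

variable (p : ℕ) [Fact p.Prime] (Vmod : Type 1)

/-- **`hoverPlus` at the genuine carrier**: every homotopy of the universal `⊞`-observable family `S_log⊞_v` of `genuineOpen p V`,
read inside `D_{An⊢}`, lies over the core `An⊢[𝒩⊢⊞]` for the mono-telecore over-datum (`hN := Iso.refl`, `hψ :=`
`nonarchGenuineMonoAnPfOpen_ψOverIso`) — abc-iut-f-101's bridge over abc-iut-w5-d144's `isOver_logObsFamily_η_map`.
[cite: MochizukiAbsTopIII2015, Remark 3.5.1 p.78] -/
theorem genuineOpen_isOver_embPlusHom (v : Vmod) (a : (logShapePlus (isArc := fun _ : Vmod => false) v).Vertex)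
    (q r : Path a (logShapePlus (isArc := fun _ : Vmod => false) v).obs)
    (h : ((genuineOpen p Vmod).logObsFamily v (genuineOpen_iotaSquaresCommute p Vmod v)).E q r) :
    ((genuineOpen p Vmod).monoTeleOver (fun _ => Iso.refl _)
        (fun w j => nonarchGenuineMonoAnPfOpen_ψOverIso p Vmod (fun _ => false) w j)).IsOver
      ((embMonoPlus (monoJ (Vmod := Vmod)) v).mapPath q) ((embMonoPlus (monoJ (Vmod := Vmod)) v).mapPath r)
      ((genuineOpen p Vmod).embPlusHom v
        ((genuineOpen p Vmod).logObsFamily v (genuineOpen_iotaSquaresCommute p Vmod v)) h) :=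
  (genuineOpen p Vmod).isOver_embPlusHom_of_isOver _ _ v _
    (fun h' => (genuineOpen p Vmod).isOver_logObsFamily_η_map v
      (nonarchGenuineMonoAnPfOpen_iotaOver p Vmod (fun _ => false))
      (nonarchGenuineMonoAnPfOpen_lamOverLink p Vmod (fun _ => false)) _ _ h') a q r h

/-- **`hoverTS` at the genuine carrier**, for every `TS`-datum `T` whose `ι` lie over `Th•[Z]` (`T.IotaOverTS`): every homotopy of
the universal `TS`-observable family `S_log_v`, read inside `D_{An⊢}`, lies over the core — abc-iut-f-101's bridge over
abc-iut-w5-d144's `isOver_logObsFamilyTS_η_map`. [cite: MochizukiAbsTopIII2015, Remark 3.5.1 p.78] -/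
theorem genuineOpen_isOver_embTSHom (T : (genuineOpen p Vmod).TSHomotopies) (hT : T.IotaOverTS) (v : Vmod)
    (a : (logShapeTS (isArc := fun _ : Vmod => false) v).Vertex)
    (q r : Path a (logShapeTS (isArc := fun _ : Vmod => false) v).obs)
    (h : ((genuineOpen p Vmod).logObsFamilyTS v T (genuineOpen_iotaSquaresCommuteTS p Vmod T v)).E q r) :
    ((genuineOpen p Vmod).monoTeleOver (fun _ => Iso.refl _)
        (fun w j => nonarchGenuineMonoAnPfOpen_ψOverIso p Vmod (fun _ => false) w j)).IsOver
      ((embMonoTS (monoJ (Vmod := Vmod)) v).mapPath q) ((embMonoTS (monoJ (Vmod := Vmod)) v).mapPath r)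
      ((genuineOpen p Vmod).embTSHom v
        ((genuineOpen p Vmod).logObsFamilyTS v T (genuineOpen_iotaSquaresCommuteTS p Vmod T v)) h) :=
  (genuineOpen p Vmod).isOver_embTSHom_of_isOver _ _ v _
    (fun h' => (genuineOpen p Vmod).isOver_logObsFamilyTS_η_map v T hT
      (nonarchGenuineMonoAnPfOpen_lamOverLink p Vmod (fun _ => false)) _ _ h') a q r h

/-- ★ **Cor 5.10 (iv)(b), «compatible with `S_log`, `S_log⊞`», AT THE GENUINE OPEN-AUGMENTATION CARRIER, for every `TS`-datum `T`
with `T.IotaOverTS`** (`V ≠ ∅`): ONE family of homotopies on `D_{An⊢}` contains the telecore family `𝒥` of `𝔗_{An⊢}` and the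
embedded observable families `S_log⊞_v`, `S_log_v` at every `v` — abc-iut-f-101's D2 with every binder discharged at the carrier.
[cite: MochizukiAbsTopIII2015, Cor 5.10 (iv)(b) p. 147] -/
theorem cor510MonoTelecoreObservablesCompatible_genuineOpen_of_iotaOverTS [Nonempty Vmod]
    (T : (genuineOpen p Vmod).TSHomotopies) (hT : T.IotaOverTS) :
    (genuineOpen p Vmod).Cor510MonoTelecoreObservablesCompatible T :=
  (genuineOpen p Vmod).cor510MonoTelecoreObservablesCompatible_of
    (TS := T)
    (hN := fun _ => Iso.refl _)
    (hψ := fun w j => nonarchGenuineMonoAnPfOpen_ψOverIso p Vmod (fun _ => false) w j)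
    (Hplus := fun v => (genuineOpen p Vmod).logObsFamily v (genuineOpen_iotaSquaresCommute p Vmod v))
    (Hts := fun v => (genuineOpen p Vmod).logObsFamilyTS v T (genuineOpen_iotaSquaresCommuteTS p Vmod T v))
    (hpush := fun v => (genuineOpen p Vmod).subFamily_pushFamily_logObsFamilyTS v T _ _)
    (hoverPlus := fun v a q r h => genuineOpen_isOver_embPlusHom p Vmod v a q r h)
    (hoverTS := fun v a q r h => genuineOpen_isOver_embTSHom p Vmod T hT v a q r h)
    (hobs := fun v => genuineOpen_isLogObservable_pair p Vmod T v)

/-- ★★ **Cor 5.10 (iv)(b), «compatible with `S_log`, `S_log⊞`», AT THE GENUINE OPEN-AUGMENTATION CARRIER with its own `TS`-datum**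
(`genuineOpenTS p V`; zero hypotheses beyond `V ≠ ∅`). [cite: MochizukiAbsTopIII2015, Cor 5.10 (iv)(b) p. 147] -/
theorem cor510MonoTelecoreObservablesCompatible_genuineOpen [Nonempty Vmod] :
    (genuineOpen p Vmod).Cor510MonoTelecoreObservablesCompatible (genuineOpenTS p Vmod) :=
  cor510MonoTelecoreObservablesCompatible_genuineOpen_of_iotaOverTS p Vmod (genuineOpenTS p Vmod)
    (genuineOpenTS_iotaOverTS p Vmod)

/-- **The statement at the genuine carrier EXACTLY**: it holds iff `V(F_mod) ≠ ∅` (abc-iut-w5-d144's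
`not_cor510MonoTelecoreObservablesCompatible_of_isEmpty` is the degenerate corner). [cite: MochizukiAbsTopIII2015, Cor 5.10 (iv)(b) p. 147] -/
theorem cor510MonoTelecoreObservablesCompatible_genuineOpen_iff :
    (genuineOpen p Vmod).Cor510MonoTelecoreObservablesCompatible (genuineOpenTS p Vmod) ↔ Nonempty Vmod := by
  refine ⟨fun h => ?_, fun _ => cor510MonoTelecoreObservablesCompatible_genuineOpen p Vmod⟩
  by_contra hV
  haveI : IsEmpty Vmod := not_nonempty_iff.mp hV
  exact (genuineOpen p Vmod).not_cor510MonoTelecoreObservablesCompatible_of_isEmpty (genuineOpenTS p Vmod) h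

end Instance

/-- Hence a §5 setting with `V(F_mod) ≠ ∅` and a `TS`-datum satisfying the typed (b)-clause EXIST (model-level non-vacuity of
abc-iut-w5-d144's `Cor510MonoTelecoreObservablesCompatible`). [cite: MochizukiAbsTopIII2015, Cor 5.10 (iv)(b) p. 147] -/
theorem exists_genuine_cor510MonoTelecoreObservablesCompatible (p : ℕ) [Fact p.Prime] (Vmod : Type 1) [Nonempty Vmod] :
    ∃ (L : LogFrobeniusSetting Vmod (fun _ => false)) (T : L.TSHomotopies), L.Cor510MonoTelecoreObservablesCompatible T :=
  ⟨genuineOpen p Vmod, genuineOpenTS p Vmod, cor510MonoTelecoreObservablesCompatible_genuineOpen p Vmod⟩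

end LogFrobeniusSetting

end Literature.AnabelianGeometry.AbsoluteAnabelian
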